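import Summits.Ventures.CertifiedManyBodySolver.Observables.SourcedOrderParameterFloor
import Mathlib.Analysis.Convex.Deriv
import Mathlib.Analysis.Convex.SpecificFunctions.Basic
import Mathlib.Analysis.SpecialFunctions.Pow.Deriv
import Mathlib.MeasureTheory.Integral.IntervalIntegral.Basic
import HarnessLib

/-!
# The `h`-uniformity schema: what turns finite-field response floors into an order-parameter floor
(cell hubbard-cq, split of record 2026-08-26 15:28Z, row T3; sharpness in `ResponseModulusSharpness.lean`)

Pure real analysis over `ConvexOn` / `ConcaveOn`, plus its reading in the tree's sourced `d`-wave
vocabulary (`dWaveSourceTorus`, `dWaveSourceDensity`, `dWaveOrderParameter`,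
`SourcedOrderParameterFloor.lean`). Objects: `e : ℝ → ℝ` is a sourced ground-state energy density
as a function of the source `h ≥ 0` (finite-`L`: `E_L(h)/L²`; thermodynamic limit: `e(h)`), CONCAVE
in `h`; the response is `m(h) = −e′(h)/2` where it exists, certified data are CHORDS
`(e(t) − e(h₁))/(2(h₁ − t)) ≤ m(h₁⁻)` (`t < h₁`, left chord = floor) and the order parameter is the
CUSP `m* = inf_{s>0} (e(0) − e(s))/(2s) = −∂⁺e(0)/2` (tree: `dWaveOrderParameter_eq_iInf`,
`le_dWaveOrderParameter_of_forall`). Concavity alone makes `s ↦ (e 0 − e s)/(2s)` non-decreasing, so a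
floor at a field `h₁ > 0` says NOTHING about `m*`; the missing input is a MODULUS at `0⁺`.

## §1 The schema (door E1a: data + modulus ⇒ floor)

MOD(Φ): `h ↦ e h + Φ h` is CONVEX on `[0, h₁]` ("`e` is concave but not more concave than `−Φ`";
for `C²` curves and `Φ = K h^p`, `K = 2C/((1−α)(2−α))`, `p = 2 − α`, this is the susceptibility
bound `χ(h) = m′(h) = −e″(h)/2 ≤ C h^{−α}`, `α < 1`, see `convexOn_add_rpow_of_susceptibility_le`).

* `chordFloor_le_cuspChord_of_convexOn_add` — MOD(Φ) ⇒ for all `0 < s ≤ h₁`, `0 ≤ t < h₁`: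
  `(e t − e h₁)/(2(h₁−t)) − ½[(Φ h₁ − Φ t)/(h₁ − t) − (Φ s − Φ 0)/s] ≤ (e 0 − e s)/(2s)`;
* `chordFloor_sub_le_cuspChord_of_convexOn_add_rpow` — `Φ = K h^p`, `K ≥ 0`, `p ≥ 1`:
  `(e t − e h₁)/(2(h₁−t)) − (Kp/2) h₁^{p−1} ≤ (e 0 − e s)/(2s)`;
  `chordFloor_sub_le_cuspChord_powerLaw` — the same with `(C, α)`: loss `C h₁^{1−α}/(1−α)`;
  `negHalfDeriv_sub_le_cuspChord_of_convexOn_add_rpow` — tangent form (response `−e′(h₁⁻)/2` as datum);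
  `le_neg_half_rightDeriv_of_forall_cuspChord` — cusp chords ⇒ `−∂⁺e(0)/2`;
* `modulusFloorSchema`, `modulusFloorChord` — the bookkeeping shapes of lens seat negation-1
  (tangent: `mlo − ω(h_b) ≤ m*`; chord: `(e_lo(0) − e_hi(h))/(2h) − h⁻¹∫₀ʰ ω ≤ m*` from the gain
  identity `e(0) − e(h) = 2∫₀ʰ m` and MOD `m − m* ≤ ω` on `(0,h]`), landed verbatim;
* `le_dWaveOrderParameter_of_tendsto_of_convexOn_add_rpow` (TL form) and
  `le_dWaveOrderParameter_of_windows_of_uniform_modulus` (CERTIFIED-DATA form: two sourced energy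
  windows `ℓ (L+1)² ≤ E_{L+1}(t)`, `E_{L+1}(h₁) ≤ u (L+1)²` for all large `L` + an `L`-UNIFORM modulus
  ⇒ `(ℓ − u)/(2(h₁ − t)) − (Kp/2) h₁^{p−1} ≤ dWaveOrderParameter U μ`).

## Sharpness (companion file `ResponseModulusSharpness.lean`)

Without a modulus NO functional of finite-field data floors `m*`: the flat truncation
`h ↦ min (e h) (e κ)` (same data at every field `≥ κ`, order parameter `0`) and the `ε`-lift
`h ↦ min (e 0) (e h + ε)` (`ε`-close at every field, same response wherever the gain is `≥ ε`, order
parameter `0`) are proved there, with the no-floor corollaries.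

Not here: the physical (Goldstone) form of the modulus and who certifies it (no producer exists —
census line (13) of the cell); the equality case of §1 (`e h = −2mh − K h^p` attains the loss term
in the limit `t → h₁`; remark only); thermodynamic-limit existence of `e` (seat p5 / obsth-2).
-/

noncomputable section

namespace Summit.Ventures.CertifiedManyBodySolver.Observables

open Set Filter Topology Literature.MathematicalPhysics.QuantumLattice

namespace ResponseModulus

/-! ### §1a The schema in chord form, general modulus primitive `Φ` -/

/-- **Chord-floor transfer under MOD(Φ).** If `h ↦ e h + Φ h` is convex on `[0, h₁]`, then for every
`0 < s ≤ h₁` and `0 ≤ t < h₁` the left chord at `h₁` (a certified response floor at the working field)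
minus the modulus price `½[(Φ h₁ − Φ t)/(h₁ − t) − (Φ s − Φ 0)/s]` is below the cusp chord at `s`:
three-chord inequality `slope(0,s) ≤ slope(0,h₁) ≤ slope(t,h₁)` for the convex `e + Φ`. No hypothesis
on `e` alone is needed. -/
theorem chordFloor_le_cuspChord_of_convexOn_add {e Φ : ℝ → ℝ} {h₁ s t : ℝ}
    (hconv : ConvexOn ℝ (Icc 0 h₁) (fun h => e h + Φ h))
    (hs : 0 < s) (hs₁ : s ≤ h₁) (ht : 0 ≤ t) (ht₁ : t < h₁) :
    (e t - e h₁) / (2 * (h₁ - t)) - ((Φ h₁ - Φ t) / (h₁ - t) - (Φ s - Φ 0) / s) / 2 ≤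
      (e 0 - e s) / (2 * s) := by
  have hh₁ : 0 < h₁ := hs.trans_le hs₁
  have h0I : (0 : ℝ) ∈ Icc 0 h₁ := ⟨le_rfl, hh₁.le⟩
  have hsI : s ∈ Icc 0 h₁ := ⟨hs.le, hs₁⟩
  have htI : t ∈ Icc 0 h₁ := ⟨ht, ht₁.le⟩
  have h1I : h₁ ∈ Icc 0 h₁ := ⟨hh₁.le, le_rfl⟩
  have step1 := hconv.secant_mono h0I hsI h1I hs.ne' hh₁.ne' hs₁
  have step2 := hconv.secant_mono h1I h0I htI hh₁.ne ht₁.ne ht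
  simp only [sub_zero] at step1
  have e1 : (e h₁ + Φ h₁ - (e 0 + Φ 0)) / h₁ = (e 0 + Φ 0 - (e h₁ + Φ h₁)) / (0 - h₁) := by
    rw [zero_sub, div_neg, ← neg_div, neg_sub]
  rw [e1] at step1
  have key := step1.trans step2
  have hts : 0 < h₁ - t := sub_pos.2 ht₁
  have e2 : (e t + Φ t - (e h₁ + Φ h₁)) / (t - h₁) = (e h₁ - e t) / (h₁ - t) + (Φ h₁ - Φ t) / (h₁ - t) := by
    rw [← add_div, show t - h₁ = -(h₁ - t) by ring, div_neg, ← neg_div]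
    ring_nf
  have e3 : (e s + Φ s - (e 0 + Φ 0)) / s = (e s - e 0) / s + (Φ s - Φ 0) / s := by
    rw [← add_div]; ring_nf
  rw [e2, e3] at key
  have e4 : (e t - e h₁) / (2 * (h₁ - t)) = -((e h₁ - e t) / (h₁ - t)) / 2 := by
    field_simp
    ring
  have e5 : (e 0 - e s) / (2 * s) = -((e s - e 0) / s) / 2 := by
    field_simp
    ring
  rw [e4, e5]
  linarith

/-! ### §1b Power-law modulus `Φ = K h^p` (`χ ≤ C h^{−α}`, `p = 2 − α`, `K = 2C/((1−α)(2−α))`) -/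

/-- Secants of `x ↦ x^p`, `p ≥ 1`, on `[0, ∞)` lie below the tangent at the right end point:
`(h₁^p − t^p)/(h₁ − t) ≤ p h₁^{p−1}` (`convexOn_rpow`). -/
theorem rpow_secant_le {p t h₁ : ℝ} (hp : 1 ≤ p) (ht : 0 ≤ t) (ht₁ : t < h₁) :
    (h₁ ^ p - t ^ p) / (h₁ - t) ≤ p * h₁ ^ (p - 1) := by
  have hh₁ : 0 < h₁ := ht.trans_lt ht₁
  have hd : HasDerivAt (fun x : ℝ => x ^ p) (p * h₁ ^ (p - 1)) h₁ :=
    Real.hasDerivAt_rpow_const (Or.inl hh₁.ne')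
  have h := (convexOn_rpow hp).slope_le_of_hasDerivAt (mem_Ici.2 ht) (mem_Ici.2 hh₁.le) ht₁ hd
  rwa [slope_def_field] at h

/-- **Chord-floor transfer, power-law modulus.** If `h ↦ e h + K h^p` is convex on `[0, h₁]` with
`K ≥ 0`, `p ≥ 1`, then for all `0 < s ≤ h₁`, `0 ≤ t < h₁`:
`(e t − e h₁)/(2(h₁ − t)) − (K p / 2)·h₁^{p−1} ≤ (e 0 − e s)/(2 s)`. -/
theorem chordFloor_sub_le_cuspChord_of_convexOn_add_rpow {e : ℝ → ℝ} {K p h₁ s t : ℝ}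
    (hK : 0 ≤ K) (hp : 1 ≤ p)
    (hconv : ConvexOn ℝ (Icc 0 h₁) (fun h => e h + K * h ^ p))
    (hs : 0 < s) (hs₁ : s ≤ h₁) (ht : 0 ≤ t) (ht₁ : t < h₁) :
    (e t - e h₁) / (2 * (h₁ - t)) - K * p / 2 * h₁ ^ (p - 1) ≤ (e 0 - e s) / (2 * s) := by
  have h := chordFloor_le_cuspChord_of_convexOn_add (Φ := fun h => K * h ^ p) hconv hs hs₁ ht ht₁
  have hsec : (K * h₁ ^ p - K * t ^ p) / (h₁ - t) ≤ K * (p * h₁ ^ (p - 1)) := by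
    rw [← mul_sub, mul_div_assoc]
    exact mul_le_mul_of_nonneg_left (rpow_secant_le hp ht ht₁) hK
  have hP : 0 ≤ (K * s ^ p - K * (0 : ℝ) ^ p) / s := by
    rw [Real.zero_rpow (by linarith : p ≠ 0), mul_zero, sub_zero]
    exact div_nonneg (mul_nonneg hK (Real.rpow_nonneg hs.le p)) hs.le
  have e1 : K * p / 2 * h₁ ^ (p - 1) = K * (p * h₁ ^ (p - 1)) / 2 := by ring
  rw [e1]
  linarith

/-- **Chord-floor transfer, susceptibility exponent form** (the T3 wording of the split of record):
if `h ↦ e h + (2C/((1−α)(2−α))) h^{2−α}` is convex on `[0, h₁]` (`C ≥ 0`, `α < 1`; for smooth `e`: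
`χ ≤ C h^{−α}`), then `(e t − e h₁)/(2(h₁ − t)) − C h₁^{1−α}/(1−α) ≤ (e 0 − e s)/(2s)` for all
`0 < s ≤ h₁`, `0 ≤ t < h₁` — i.e. `m* ≥ m₁ − C h₁^{1−α}/(1−α)` for every certified chord floor `m₁`
at the working field. -/
theorem chordFloor_sub_le_cuspChord_powerLaw {e : ℝ → ℝ} {C α h₁ s t : ℝ}
    (hC : 0 ≤ C) (hα : α < 1)
    (hconv : ConvexOn ℝ (Icc 0 h₁) (fun h => e h + 2 * C / ((1 - α) * (2 - α)) * h ^ (2 - α)))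
    (hs : 0 < s) (hs₁ : s ≤ h₁) (ht : 0 ≤ t) (ht₁ : t < h₁) :
    (e t - e h₁) / (2 * (h₁ - t)) - C / (1 - α) * h₁ ^ (1 - α) ≤ (e 0 - e s) / (2 * s) := by
  have h1α : 0 < 1 - α := by linarith
  have h2α : 0 < 2 - α := by linarith
  have hK : 0 ≤ 2 * C / ((1 - α) * (2 - α)) := by positivity
  have hp : (1 : ℝ) ≤ 2 - α := by linarith
  have h := chordFloor_sub_le_cuspChord_of_convexOn_add_rpow hK hp hconv hs hs₁ ht ht₁
  have e1 : 2 * C / ((1 - α) * (2 - α)) * (2 - α) / 2 * h₁ ^ (2 - α - 1) =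
      C / (1 - α) * h₁ ^ (1 - α) := by
    rw [show (2 : ℝ) - α - 1 = 1 - α by ring]
    field_simp
  rwa [e1] at h

/-- **Tangent form at the working field.** If `h ↦ e h + K h^p` is convex on `[0, h₁]` (`K ≥ 0`,
`p ≥ 1`) and `e` has LEFT derivative `d₁` at `h₁` (response datum `m(h₁⁻) = −d₁/2`), then
`−d₁/2 − (K p/2) h₁^{p−1} ≤ (e 0 − e s)/(2s)` for all `0 < s ≤ h₁`. -/
theorem negHalfDeriv_sub_le_cuspChord_of_convexOn_add_rpow {e : ℝ → ℝ} {K p h₁ s d₁ : ℝ}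
    (hK : 0 ≤ K) (hp : 1 ≤ p)
    (hconv : ConvexOn ℝ (Icc 0 h₁) (fun h => e h + K * h ^ p))
    (hd : HasDerivWithinAt e d₁ (Iio h₁) h₁)
    (hs : 0 < s) (hs₁ : s ≤ h₁) :
    -d₁ / 2 - K * p / 2 * h₁ ^ (p - 1) ≤ (e 0 - e s) / (2 * s) := by
  have hh₁ : 0 < h₁ := hs.trans_le hs₁
  have h0I : (0 : ℝ) ∈ Icc 0 h₁ := ⟨le_rfl, hh₁.le⟩
  have hsI : s ∈ Icc 0 h₁ := ⟨hs.le, hs₁⟩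
  have h1I : h₁ ∈ Icc 0 h₁ := ⟨hh₁.le, le_rfl⟩
  -- derivative of the convex combination at h₁ from the left
  have hΦ : HasDerivWithinAt (fun x : ℝ => K * x ^ p) (K * (p * h₁ ^ (p - 1))) (Iio h₁) h₁ :=
    ((Real.hasDerivAt_rpow_const (Or.inl hh₁.ne')).const_mul K).hasDerivWithinAt
  have hg : HasDerivWithinAt (fun h => e h + K * h ^ p) (d₁ + K * (p * h₁ ^ (p - 1))) (Iio h₁) h₁ :=
    hd.add hΦ
  have step2 := hconv.slope_le_of_hasDerivWithinAt_Iio h0I h1I hh₁ hg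
  have step1 := hconv.secant_mono h0I hsI h1I hs.ne' hh₁.ne' hs₁
  simp only [sub_zero] at step1
  rw [slope_def_field, sub_zero] at step2
  have key := step1.trans step2
  rw [Real.zero_rpow (by linarith : p ≠ 0), mul_zero, add_zero] at key
  have hP : 0 ≤ K * s ^ p := mul_nonneg hK (Real.rpow_nonneg hs.le p)
  have e5 : (e 0 - e s) / (2 * s) = -((e s + K * s ^ p - e 0) / s) / 2 + K * s ^ p / s / 2 := by
    field_simp
    ring
  rw [e5]
  have hP' : 0 ≤ K * s ^ p / s / 2 := by positivity
  have e6 : -d₁ / 2 - K * p / 2 * h₁ ^ (p - 1) = -(d₁ + K * (p * h₁ ^ (p - 1))) / 2 := by ring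
  rw [e6]
  linarith

/-- **From cusp chords to the right derivative.** If `F ≤ (e 0 − e s)/(2s)` for all `s ∈ (0, h₁)` and
`e` has right derivative `d` at `0`, then `F ≤ −d/2` (`m* = −∂⁺e(0)/2`). -/
theorem le_neg_half_rightDeriv_of_forall_cuspChord {e : ℝ → ℝ} {F d h₁ : ℝ} (hh₁ : 0 < h₁)
    (hF : ∀ s ∈ Ioo 0 h₁, F ≤ (e 0 - e s) / (2 * s))
    (hd : HasDerivWithinAt e d (Ioi 0) 0) : F ≤ -d / 2 := by
  have ht : Tendsto (slope e 0) (𝓝[>] 0) (𝓝 d) := by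
    have h := hasDerivWithinAt_iff_tendsto_slope.1 hd
    rwa [sdiff_singleton_eq_self (fun h : (0 : ℝ) ∈ Ioi 0 => lt_irrefl _ h)] at h
  have ht2 : Tendsto (fun s => -(slope e 0 s) / 2) (𝓝[>] 0) (𝓝 (-d / 2)) :=
    ht.neg.div_const 2
  refine ge_of_tendsto ht2 ?_
  filter_upwards [Ioo_mem_nhdsGT hh₁] with s hs
  have h := hF s hs
  rw [slope_def_field, sub_zero]
  have e1 : -((e s - e 0) / s) / 2 = (e 0 - e s) / (2 * s) := by
    field_simp
    ring
  rwa [e1]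

/-- **Susceptibility bound ⇒ MOD.** If `e` is continuous on `[0, h₁]`, twice differentiable on
`(0, h₁)` with `e′ = e₁`, `e₁′ = e₂` there, and the susceptibility `χ = −e₂/2` obeys
`χ(h) ≤ C h^{−α}` on `(0, h₁)` with `α < 1`, then `h ↦ e h + (2C/((1−α)(2−α))) h^{2−α}` is convex on
`[0, h₁]` (its second derivative is `e₂ + 2C h^{−α} ≥ 0`). -/
theorem convexOn_add_rpow_of_susceptibility_le {e e₁ e₂ : ℝ → ℝ} {C α h₁ : ℝ}
    (hα : α < 1) (hcont : ContinuousOn e (Icc 0 h₁))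
    (hd1 : ∀ h ∈ Ioo 0 h₁, HasDerivAt e (e₁ h) h)
    (hd2 : ∀ h ∈ Ioo 0 h₁, HasDerivAt e₁ (e₂ h) h)
    (hχ : ∀ h ∈ Ioo 0 h₁, -(e₂ h) / 2 ≤ C * h ^ (-α)) :
    ConvexOn ℝ (Icc 0 h₁) (fun h => e h + 2 * C / ((1 - α) * (2 - α)) * h ^ (2 - α)) := by
  have h1α : 0 < 1 - α := by linarith
  have h2α : 0 < 2 - α := by linarith
  set K : ℝ := 2 * C / ((1 - α) * (2 - α)) with hKdef
  rcases le_or_gt h₁ 0 with hle | hpos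
  · -- degenerate interval
    refine ⟨convex_Icc 0 h₁, ?_⟩
    intro x hx y hy a b ha hb hab
    have hx0 : x = 0 := le_antisymm (hx.2.trans hle) hx.1
    have hy0 : y = 0 := le_antisymm (hy.2.trans hle) hy.1
    subst hx0 hy0
    have e0 : a • (0 : ℝ) + b • 0 = 0 := by simp
    rw [e0, smul_eq_mul, smul_eq_mul, ← add_mul, hab, one_mul]
  have hint : interior (Icc 0 h₁) = Ioo 0 h₁ := interior_Icc
  -- first and second derivatives of g = e + K h^{2-α} on the interior
  have hg1 : ∀ x ∈ interior (Icc 0 h₁), HasDerivWithinAt (fun h => e h + K * h ^ (2 - α))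
      (e₁ x + K * ((2 - α) * x ^ (2 - α - 1))) (interior (Icc 0 h₁)) x := by
    intro x hx
    rw [hint] at hx
    exact ((hd1 x hx).add ((Real.hasDerivAt_rpow_const (Or.inl hx.1.ne')).const_mul K)).hasDerivWithinAt
  have hg2 : ∀ x ∈ interior (Icc 0 h₁), HasDerivWithinAt (fun h => e₁ h + K * ((2 - α) * h ^ (2 - α - 1)))
      (e₂ x + K * ((2 - α) * ((2 - α - 1) * x ^ (2 - α - 1 - 1)))) (interior (Icc 0 h₁)) x := by
    intro x hx
    rw [hint] at hx
    exact ((hd2 x hx).add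
      (((Real.hasDerivAt_rpow_const (Or.inl hx.1.ne')).const_mul (2 - α)).const_mul K)).hasDerivWithinAt
  have hcontg : ContinuousOn (fun h => e h + K * h ^ (2 - α)) (Icc 0 h₁) :=
    hcont.add ((Real.continuous_rpow_const h2α.le).continuousOn.const_smul K |>.congr
      (fun x _ => by simp [smul_eq_mul]))
  refine convexOn_of_hasDerivWithinAt2_nonneg (convex_Icc 0 h₁) hcontg hg1 hg2 ?_
  intro x hx
  rw [hint] at hx
  have hx0 : 0 < x := hx.1
  have hχx := hχ x hx
  have e1 : (2 : ℝ) - α - 1 - 1 = -α := by ring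
  rw [e1]
  have e2 : K * ((2 - α) * ((2 - α - 1) * x ^ (-α))) = 2 * C * x ^ (-α) := by
    rw [hKdef, show (2 : ℝ) - α - 1 = 1 - α by ring]
    field_simp
  rw [e2]
  linarith

/-! ### §1c The bookkeeping shapes of lens seat negation-1 (landed verbatim; planners sketch,
provers land) -/

/-- **Door-E1a schema, tangent form** (negation-1 `modulusFloorSchema`). Data: a certified response
floor `mlo ≤ m hb` at the working field `hb`; hypothesis MOD: `m h − mstar ≤ ω h` on `(0, hb]`.
Conclusion: `mstar ≥ mlo − ω hb`. The two SLACKS a card must exhibit are `m hb − mlo`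
(energy-window slack) and `ω hb − (m hb − mstar)` (modulus slack). -/
theorem modulusFloorSchema {m ω : ℝ → ℝ} {mstar mlo hb : ℝ} (hb_pos : 0 < hb)
    (hMOD : ∀ h, 0 < h → h ≤ hb → m h - mstar ≤ ω h) (hdata : mlo ≤ m hb) :
    mlo - ω hb ≤ mstar := by
  have := hMOD hb hb_pos le_rfl
  linarith

/-- **Door-E1a schema, chord form** (negation-1 `modulusFloorChord`): `c_lo(h) − ω̄(h) ≤ m*` with
`c_lo = (e_lo(0) − e_hi(h))/(2h)` and `ω̄ = h⁻¹∫₀ʰ ω`, from the gain identity `e(0) − e(h) = 2∫₀ʰ m`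
(Hellmann–Feynman / FTC for the concave sourced energy, supplied by the card as a hypothesis) and
MOD `m − m* ≤ ω` on `(0,h]`. The floor a card gets is `m* − σ̄(h) − (w₀ + w_h)/(2h)` where
`w₀ = e 0 − elo0`, `w_h = ehi − e h`, `σ̄ = ω̄ − h⁻¹∫(m − m*)` — all three visible in the
hypotheses. -/
theorem modulusFloorChord {m ω : ℝ → ℝ} {mstar e0 eh elo0 ehi h : ℝ} (hh : 0 < h)
    (hm : IntervalIntegrable m MeasureTheory.volume 0 h)
    (hω : IntervalIntegrable ω MeasureTheory.volume 0 h)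
    (hgain : e0 - eh = 2 * ∫ s in (0:ℝ)..h, m s)
    (hMOD : ∀ s ∈ Set.Ioc (0:ℝ) h, m s - mstar ≤ ω s)
    (hlo : elo0 ≤ e0) (hhi : eh ≤ ehi) :
    (elo0 - ehi) / (2 * h) - (∫ s in (0:ℝ)..h, ω s) / h ≤ mstar := by
  have hle : ∀ s ∈ Set.Icc (0:ℝ) h, s ≠ 0 → m s ≤ mstar + ω s := by
    intro s hs hs0
    have : s ∈ Set.Ioc (0:ℝ) h := ⟨lt_of_le_of_ne hs.1 (Ne.symm hs0), hs.2⟩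
    linarith [hMOD s this]
  have hint : (∫ s in (0:ℝ)..h, m s) ≤ ∫ s in (0:ℝ)..h, (mstar + ω s) := by
    have hω' : IntervalIntegrable (fun s => mstar + ω s) MeasureTheory.volume 0 h :=
      (intervalIntegrable_const).add hω
    refine intervalIntegral.integral_mono_ae_restrict hh.le hm hω' ?_
    have hmem : ∀ᵐ s ∂MeasureTheory.volume.restrict (Set.Icc (0:ℝ) h), s ∈ Set.Icc (0:ℝ) h :=
      MeasureTheory.ae_restrict_mem measurableSet_Icc
    have h0 : ∀ᵐ s ∂MeasureTheory.volume, s ≠ (0:ℝ) := by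
      rw [MeasureTheory.ae_iff]
      have : {a : ℝ | ¬a ≠ 0} = {0} := by ext a; simp
      rw [this]; exact Real.volume_singleton
    filter_upwards [hmem, MeasureTheory.ae_restrict_of_ae h0] with s hs hs0
    exact hle s hs hs0
  have hsplit : (∫ s in (0:ℝ)..h, (mstar + ω s)) = mstar * h + ∫ s in (0:ℝ)..h, ω s := by
    rw [intervalIntegral.integral_add intervalIntegrable_const hω, intervalIntegral.integral_const,
      smul_eq_mul]
    ring
  rw [hsplit] at hint
  have h2 : elo0 - ehi ≤ 2 * (mstar * h + ∫ s in (0:ℝ)..h, ω s) := by linarith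
  have h2h : (0:ℝ) < 2 * h := by linarith
  have h3 : (elo0 - ehi) / (2 * h) ≤ mstar + (∫ s in (0:ℝ)..h, ω s) / h := by
    rw [div_le_iff₀ h2h]
    have : (mstar + (∫ s in (0:ℝ)..h, ω s) / h) * (2 * h)
        = 2 * (mstar * h + ∫ s in (0:ℝ)..h, ω s) := by field_simp
    rw [this]; exact h2
  linarith

end ResponseModulus

/-! ### §1d The schema in the tree's sourced `d`-wave vocabulary -/

/-- **TL form.** If the sourced energy densities `E_{L+1}(h)/(L+1)²` converge to `e h` at every
`h ∈ [0, h₁]`, the limit obeys MOD (`h ↦ e h + K h^p` convex on `[0,h₁]`, `K ≥ 0`, `p ≥ 1`), and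
`m₁ ≤ (e t − e h₁)/(2(h₁ − t))` is a chord floor at the working field (`0 ≤ t < h₁`), then
`m₁ − (Kp/2) h₁^{p−1} ≤ dWaveOrderParameter U μ` (stairs `s ∈ (0,h₁)` floored by the cusp chords via
`le_liminf_dWaveSourceDensity_of_tendsto`, then `le_dWaveOrderParameter_of_forall`). -/
theorem le_dWaveOrderParameter_of_tendsto_of_convexOn_add_rpow (U μ : ℝ) {e : ℝ → ℝ}
    {K p h₁ t m₁ : ℝ} (hK : 0 ≤ K) (hp : 1 ≤ p) (ht : 0 ≤ t) (ht₁ : t < h₁)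
    (hlim : ∀ h ∈ Icc 0 h₁, Tendsto (fun L : ℕ =>
      (dWaveSourceTorus (L + 1) U μ h).groundEnergy / (((L + 1 : ℕ) : ℝ)) ^ 2) atTop (𝓝 (e h)))
    (hconv : ConvexOn ℝ (Icc 0 h₁) (fun h => e h + K * h ^ p))
    (hm₁ : m₁ ≤ (e t - e h₁) / (2 * (h₁ - t))) :
    m₁ - K * p / 2 * h₁ ^ (p - 1) ≤ dWaveOrderParameter U μ := by
  have hh₁ : 0 < h₁ := ht.trans_lt ht₁
  refine le_dWaveOrderParameter_of_forall U μ hh₁ fun s hs => ?_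
  have h1 := ResponseModulus.chordFloor_sub_le_cuspChord_of_convexOn_add_rpow hK hp hconv
    hs.1 hs.2.le ht ht₁
  have h2 := le_liminf_dWaveSourceDensity_of_tendsto U μ hs.1 (hlim 0 ⟨le_rfl, hh₁.le⟩)
    (hlim s ⟨hs.1.le, hs.2.le⟩)
  rw [sub_zero] at h2
  linarith

/-- **CERTIFIED-DATA form (door E1a in row format).** Inputs: two sourced energy windows holding for all
large tori, `ℓ (L+1)² ≤ E_{L+1}(t)` (lower, at the smaller source `t ≥ 0`) and `E_{L+1}(h₁) ≤ u (L+1)²`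
(upper, at the working field `h₁ > t`), and an `L`-UNIFORM modulus: for all large `L`,
`h ↦ E_{L+1}(h)/(L+1)² + K h^p` is convex on `[0, h₁]` (`K ≥ 0`, `p ≥ 1`). Output:
`(ℓ − u)/(2(h₁ − t)) − (Kp/2) h₁^{p−1} ≤ dWaveOrderParameter U μ`. The first term is the tree's stair
floor (`le_liminf_dWaveSourceDensity_of_window`); the modulus is the input no energy window supplies. -/
theorem le_dWaveOrderParameter_of_windows_of_uniform_modulus (U μ : ℝ) {K p h₁ t u ℓ : ℝ}
    (hK : 0 ≤ K) (hp : 1 ≤ p) (ht : 0 ≤ t) (ht₁ : t < h₁)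
    (hmod : ∀ᶠ L : ℕ in atTop, ConvexOn ℝ (Icc 0 h₁)
      (fun h => (dWaveSourceTorus (L + 1) U μ h).groundEnergy / (((L + 1 : ℕ) : ℝ)) ^ 2 + K * h ^ p))
    (hl : ∀ᶠ L : ℕ in atTop, ℓ * (((L + 1 : ℕ) : ℝ)) ^ 2 ≤ (dWaveSourceTorus (L + 1) U μ t).groundEnergy)
    (hu : ∀ᶠ L : ℕ in atTop,
      (dWaveSourceTorus (L + 1) U μ h₁).groundEnergy ≤ u * (((L + 1 : ℕ) : ℝ)) ^ 2) :
    (ℓ - u) / (2 * (h₁ - t)) - K * p / 2 * h₁ ^ (p - 1) ≤ dWaveOrderParameter U μ := by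
  have hh₁ : 0 < h₁ := ht.trans_lt ht₁
  refine le_dWaveOrderParameter_of_forall U μ hh₁ fun s hs => ?_
  refine le_liminf_of_le (isBoundedUnder_le_dWaveSourceDensity U μ s).isCoboundedUnder_ge ?_
  filter_upwards [hmod, hl, hu] with L hmodL hlL huL
  have hLsq : (0 : ℝ) < (((L + 1 : ℕ) : ℝ)) ^ 2 := by positivity
  have hts : 0 < h₁ - t := sub_pos.2 ht₁
  -- the windows floor the left chord of e_L = E_{L+1}/(L+1)² at h₁
  have hchord : (ℓ - u) / (2 * (h₁ - t)) ≤
      ((dWaveSourceTorus (L + 1) U μ t).groundEnergy / (((L + 1 : ℕ) : ℝ)) ^ 2 -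
        (dWaveSourceTorus (L + 1) U μ h₁).groundEnergy / (((L + 1 : ℕ) : ℝ)) ^ 2) / (2 * (h₁ - t)) := by
    rw [div_le_div_iff_of_pos_right (by positivity)]
    have h1 : ℓ ≤ (dWaveSourceTorus (L + 1) U μ t).groundEnergy / (((L + 1 : ℕ) : ℝ)) ^ 2 := by
      rw [le_div_iff₀ hLsq]; exact hlL
    have h2 : (dWaveSourceTorus (L + 1) U μ h₁).groundEnergy / (((L + 1 : ℕ) : ℝ)) ^ 2 ≤ u := by
      rw [div_le_iff₀ hLsq]; exact huL
    linarith
  have htrans := ResponseModulus.chordFloor_sub_le_cuspChord_of_convexOn_add_rpow hK hp hmodL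
    hs.1 hs.2.le ht ht₁
  -- the cusp chord of e_L at s is below m_{L+1}(s) (exact finite-volume Hellmann–Feynman chord)
  have hm : ((dWaveSourceTorus (L + 1) U μ 0).groundEnergy / (((L + 1 : ℕ) : ℝ)) ^ 2 -
      (dWaveSourceTorus (L + 1) U μ s).groundEnergy / (((L + 1 : ℕ) : ℝ)) ^ 2) / (2 * s) ≤
      dWaveSourceDensity (L + 1) U μ s := by
    have h := dWaveSourceDensity_ge_of_energy_window (L + 1) U μ hs.1
      (ℓ := (dWaveSourceTorus (L + 1) U μ 0).groundEnergy / (((L + 1 : ℕ) : ℝ)) ^ 2)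
      (u := (dWaveSourceTorus (L + 1) U μ s).groundEnergy / (((L + 1 : ℕ) : ℝ)) ^ 2)
      (by rw [div_mul_cancel₀ _ hLsq.ne']) (by rw [div_mul_cancel₀ _ hLsq.ne'])
    rwa [sub_zero] at h
  linarith

end Summit.Ventures.CertifiedManyBodySolver.Observables
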